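import Summits.CriticalPhenomena.SAWScalingLimit.Theses.SAWLoopLift
import Summits.CriticalPhenomena.SAWScalingLimit.Theorems.SAWWeldingIdentificationLimitUpgrade
import Summits.CriticalPhenomena.SAWScalingLimit.Theorems.SAWLoopFugacityFlowSLECarrier
import HarnessLib.Audit

/-!
# Crux `AvoidanceToCurves` (stmt-CriticalPhenomena-4850) — birth skeleton `Lines/birth.lean`

Route `SAWLoopLift` (route-CriticalPhenomena-SAWLoopLift, rank 6 "chordal sets-to-curves"), sub-problem
`SAWScalingLimit`. Crux, concluded BY NAME:
`Summit.CriticalPhenomena.SAWScalingLimit.Theses.SAWLoopLift.AvoidanceToCurves` — for every Dobrushin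
domain `(D; a, b)`, endpoint approximation `(a_δ, b_δ)` and chordal SLE_{8/3} law `μ` of `D`: IF the
critical `δℤ²` SAW avoidance probabilities converge, `P_δ(range γ ∩ K = ∅) → μ(range ∩ K = ∅)` as
`δ → 0⁺` for every compact regular-closed `K ⊆ D`, THEN the SAW curve laws converge in law to chordal
SLE_{8/3} (`ConvergesInLawToSLE (8/3) D (curve) (SAW.law)`).

## The line (Billingsley/Prokhorov architecture in the compact-`K` avoidance language)

Convergence in law along the countably generated filter `𝓝[>] 0` ⇐ (eventual tightness) + (every
probability subsequential weak limit `ν` equals `μ`); and `ν = μ` ⇐ `ν` is carried by SIMPLE chords of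
`(D; a, b)` + `ν` has the same `K`-avoidance masses as `μ` + laws on simple chords are DETERMINED by their
`K`-avoidance masses. Four registered stubs, each a genuine lemma stated over tree declarations:

* `stub_eventualTight` (T) — VERBATIM the shared staffed item `EventualTight` (stmt-CriticalPhenomena-1372,
  own `Cruxes/EventualTight/`; the repaired `∃ δ₀` form of the refuted all-`δ` statement stmt-0772): the
  pushed-forward critical SAW laws are a tight set for `δ ∈ (0, δ₀]`. OPEN (no annulus-crossing bound at
  `x_c`; Aizenman–Burchard Thm 1.1–1.2 / Kemppainen–Smirnov Thm 1.5 need an input not in print). Size XL.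
* `stub_simpleSubseqLimits` (S) — VERBATIM the shared staffed crux `SimpleSubseqLimits`
  (stmt-CriticalPhenomena-4982, own `Cruxes/SimpleSubseqLimits/`): every probability weak limit of the
  pushed-forward SAW laws along `s_n → 0⁺` is carried by simple chords from `a` to `b` in `cl D` meeting
  `∂D` only at `a, b`. OPEN (no-retracing / no-boundary-crawling at `x_c`). Size XL.
* `stub_avoidancePassageK` (P) — NEW, the compact-`K` twin of the PROVED hull-language item
  `SAWLoopFugacityFlow.AvoidancePassage` (stmt-4984, `Theorems.avoidancePassage_proof`): if the lattice
  avoidance probabilities of compact regular-closed `K ⊆ D` converge along `𝓝[>] 0` to `μ(avoid K)` for a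
  PROBABILITY measure `μ`, then every probability weak subsequential limit `ν` has `ν(avoid K) = μ(avoid K)`
  for all such `K`. Portmanteau both ways with NO continuity-set hypothesis: `{range ∩ K = ∅}` is open
  (`ν ≤ liminf`), and `⊇ {range ∩ U = ∅}` closed for open `U ⊇ K`, squeezed by the closed thickenings
  `cthickening ε K ⊆ D` (compact, regular closed, `avoid (cthickening ε K) ↑ avoid K` as `ε ↓ 0` since
  ranges are compact) and continuity from below of `μ`. Provable now; size M.
* `stub_avoidanceDeterminesLawK` (D) — NEW, the compact-`K` twin of the PROVED hull-language item
  `AvoidanceDeterminesLaw` (stmt-1373, `AvoidanceDeterminesLaw_holds`): two probability measures on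
  `CurveClass ℂ` carried by simple chords of `(D; a, b)` with equal masses on every event
  `{range ∩ K = ∅}`, `K ⊆ D` compact regular-closed, are equal. LSW03 Lemma 3.2 ("the law of `K` is
  determined by `P[K ∩ A = ∅]`", π-system) + Lusin–Souslin (`CurveClass.Measure.ext_of_missCode_injOn`,
  `CurveClass.eq_of_mem_simple_of_range_eq`, tree `SimpleCurveLaws.lean`; test sets: small closed discs
  inside `D` centred on a dense sequence — compact, regular closed, they separate points of `D` from
  compact sets, and a simple chord meeting `∂D` only at `a, b` is the closure of its part in `D`).
  Provable now; size M–L. (Without the `simple` carrier it is FALSE: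
  `Cruxes/SimpleSubseqLimits/Disproof.lean`, `avoidanceDeterminesLaw_false_without_simple`.)

`AvoidanceToCurves_of : Stubs.stub_eventualTight → Stubs.stub_simpleSubseqLimits →
Stubs.stub_avoidancePassageK → Stubs.stub_avoidanceDeterminesLawK → AvoidanceToCurves` is PROVED below
(no `sorry`): `μ` is a probability law carried by simple chords (tree THEOREM `SLECarrier_proof`,
stmt-4985: Rohde–Schramm Thm 6.1 via `IsSLELaw.ae_simple/ae_endpoints`); every probability weak limit
`P` of the SAW laws along positive meshes `δ_n → 0` equals `μ` by (D) fed with (S), `SLECarrier_proof`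
and (P); the tree THEOREM `limitUpgrade_proof` (stmt-4508: Prokhorov past the junk meshes +
`Filter.tendsto_of_subseq_tendsto`, Billingsley Thm 5.1 Corollary) turns (T) + this identification into
`TendstoLaw … id μ`; with `μ = preWienerMeasure.map Γ` (`IsSLELaw`) and `integral_map` this is
`TendstoLaw … Γ preWienerMeasure`, and measurability of `curve` is automatic (`SAW.aemeasurable_curve`).

Sorries: exactly 4 = the four `stub_*`; zero elsewhere. Disproof used: none on this crux (no
`Cruxes/AvoidanceToCurves/Disproof.lean` at registration; `ledger crux ls` empty). Negatives honoured:
stmt-0772 (all-`δ` tightness `IsTightLaws`, refuted `SAWParafermionTight_refuted`) is NOT used — (T) is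
the `∃ δ₀` repair; (T) and (S) are necessary for the conjunct (tree: `SAWScalingLimit → EventualTight`,
`Cruxes/SubseqIdentification/Disproof.lean` §6; `SimpleSubseqLimitsNecessary.lean`). BC3 probes (planner
folder `bc/probe_*.lean`): for each stub, `stub → AvoidanceToCurves` and `stub → SAWScalingLimit` by
`first | exact? | simpa | aesop` FAIL.
-/

noncomputable section

open MeasureTheory Filter Topology Set
open scoped NNReal ENNReal BoundedContinuousFunction
open Literature.Probability.RandomPlanarGeometry Literature.Probability.LatticeModels

namespace Summit.CriticalPhenomena.SAWScalingLimit.Cruxes.AvoidanceToCurves.Birth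

/-! ## The four registered stubs: precise `Prop`s `Stubs.stub_*` (hypotheses of `AvoidanceToCurves_of`
BY NAME) + the sorried theorems `stub_*` with the same statements spelled out over tree declarations -/

namespace Stubs

/-- **Stub `Prop` (T) `eventualTight`** — verbatim the shared item `EventualTight` (stmt-CriticalPhenomena-1372). -/
def stub_eventualTight : Prop :=
  ∀ (D : Literature.Probability.RandomPlanarGeometry.DobrushinDomain) (a b : ℝ → Literature.Probability.LatticeModels.Site 2), Literature.Probability.RandomPlanarGeometry.SAW.IsEndpointApprox D a b → ∃ δ₀ : ℝ, 0 < δ₀ ∧ MeasureTheory.IsTightMeasureSet ((fun δ => (Literature.Probability.RandomPlanarGeometry.SAW.law D.carrier δ (a δ) (b δ)).map (fun γ => γ.curve)) '' Set.Ioc 0 δ₀)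

/-- **Stub `Prop` (S) `simpleSubseqLimits`** — verbatim the shared crux `SimpleSubseqLimits` (stmt-CriticalPhenomena-4982). -/
def stub_simpleSubseqLimits : Prop :=
  ∀ (D : Literature.Probability.RandomPlanarGeometry.DobrushinDomain) (a b : ℝ → Literature.Probability.LatticeModels.Site 2), Literature.Probability.RandomPlanarGeometry.SAW.IsEndpointApprox D a b → ∀ (s : ℕ → ℝ) (ν : MeasureTheory.Measure (Literature.Probability.RandomPlanarGeometry.CurveClass ℂ)), Filter.Tendsto s Filter.atTop (nhdsWithin 0 (Set.Ioi 0)) → MeasureTheory.IsProbabilityMeasure ν → (∀ f : BoundedContinuousFunction (Literature.Probability.RandomPlanarGeometry.CurveClass ℂ) ℝ, Filter.Tendsto (fun n => ∫ γ, f γ.curve ∂(Literature.Probability.RandomPlanarGeometry.SAW.law D.carrier (s n) (a (s n)) (b (s n)))) Filter.atTop (nhds (∫ x, f x ∂ν))) → ∀ᵐ γ ∂ν, γ ∈ Literature.Probability.RandomPlanarGeometry.CurveClass.simple ∧ γ.source = D.pt 0 ∧ γ.target = D.pt 1 ∧ γ.range ⊆ closure D.carrier ∧ γ.range ∩ frontier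 D.carrier ⊆ {D.pt 0, D.pt 1}

/-- **Stub `Prop` (P) `avoidancePassageK`** — portmanteau passage of the convergent lattice `K`-avoidance
probabilities to every probability weak subsequential limit (compact-`K` twin of stmt-4984). -/
def stub_avoidancePassageK : Prop :=
  ∀ (D : Literature.Probability.RandomPlanarGeometry.DobrushinDomain) (a b : ℝ → Literature.Probability.LatticeModels.Site 2), Literature.Probability.RandomPlanarGeometry.SAW.IsEndpointApprox D a b → ∀ (μ : MeasureTheory.Measure (Literature.Probability.RandomPlanarGeometry.CurveClass ℂ)), MeasureTheory.IsProbabilityMeasure μ → (∀ K : Set ℂ, IsCompact K → K ⊆ D.carrier → closure (interior K) = K → Filter.Tendsto (fun δ : ℝ => ((Literature.Probability.RandomPlanarGeometry.SAW.law D.carrier δ (a δ) (b δ)) {γ | γ.curve.range ∩ K = ∅}).toReal) (nhdsWithin (0 : ℝ) (Set.Ioi 0)) (nhds (μ {γ | γ.range ∩ K = ∅}).toReal)) → ∀ (s : ℕ → ℝ) (ν : MeasureTheory.Measure (Literature.Probability.RandomPlanarGeometry.CurveClass ℂ)), Filter.Tendsto s Filter.atTop (nhdsWithin 0 (Set.Ioi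 0)) → MeasureTheory.IsProbabilityMeasure ν → (∀ f : BoundedContinuousFunction (Literature.Probability.RandomPlanarGeometry.CurveClass ℂ) ℝ, Filter.Tendsto (fun n => ∫ γ, f γ.curve ∂(Literature.Probability.RandomPlanarGeometry.SAW.law D.carrier (s n) (a (s n)) (b (s n)))) Filter.atTop (nhds (∫ x, f x ∂ν))) → ∀ K : Set ℂ, IsCompact K → K ⊆ D.carrier → closure (interior K) = K → ν {γ | γ.range ∩ K = ∅} = μ {γ | γ.range ∩ K = ∅}

/-- **Stub `Prop` (D) `avoidanceDeterminesLawK`** — laws on simple chords of `(D; a, b)` are determined by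
their compact regular-closed `K`-avoidance masses (compact-`K` twin of stmt-1373; LSW03 Lemma 3.2). -/
def stub_avoidanceDeterminesLawK : Prop :=
  ∀ (D : Literature.Probability.RandomPlanarGeometry.DobrushinDomain) (μ ν : MeasureTheory.Measure (Literature.Probability.RandomPlanarGeometry.CurveClass ℂ)), MeasureTheory.IsProbabilityMeasure μ → MeasureTheory.IsProbabilityMeasure ν → (∀ᵐ γ ∂μ, γ ∈ Literature.Probability.RandomPlanarGeometry.CurveClass.simple ∧ γ.source = D.pt 0 ∧ γ.target = D.pt 1 ∧ γ.range ⊆ closure D.carrier ∧ γ.range ∩ frontier D.carrier ⊆ {D.pt 0, D.pt 1}) → (∀ᵐ γ ∂ν, γ ∈ Literature.Probability.RandomPlanarGeometry.CurveClass.simple ∧ γ.source = D.pt 0 ∧ γ.target = D.pt 1 ∧ γ.range ⊆ closure D.carrier ∧ γ.range ∩ frontier D.carrier ⊆ {D.pt 0, D.pt 1}) → (∀ K : Set ℂ, IsCompact K → K ⊆ D.carrier → closure (interior K) = K → μ {γ | γ.range ∩ K = ∅} = ν {γ | γ.range ∩ K = ∅}) → μ = ν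

end Stubs

/-- **Stub (T) — EVENTUAL TIGHTNESS** (verbatim `EventualTight`, stmt-CriticalPhenomena-1372; OPEN, size XL):
for every Dobrushin domain and endpoint approximation there is `δ₀ > 0` such that the pushed-forward
critical SAW laws for `δ ∈ (0, δ₀]` form a tight set of measures on `CurveClass ℂ`. Needs an
annulus-crossing / no-macroscopic-oscillation bound for the critical `ℤ²` SAW (not in print).
[cite: AizenmanBurchard1999, Thm 1.1–1.2] [cite: KemppainenSmirnov2017, Thm 1.5] -/
theorem stub_eventualTight : ∀ (D : Literature.Probability.RandomPlanarGeometry.DobrushinDomain) (a b : ℝ → Literature.Probability.LatticeModels.Site 2), Literature.Probability.RandomPlanarGeometry.SAW.IsEndpointApprox D a b → ∃ δ₀ : ℝ, 0 < δ₀ ∧ MeasureTheory.IsTightMeasureSet ((fun δ => (Literature.Probability.RandomPlanarGeometry.SAW.law D.carrier δ (a δ) (b δ)).map (fun γ => γ.curve)) '' Set.Ioc 0 δ₀) := by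
  sorry

/-- **Stub (S) — SIMPLE BOUNDARY-AVOIDING SUBSEQUENTIAL LIMITS** (verbatim `SimpleSubseqLimits`,
stmt-CriticalPhenomena-4982; OPEN, size XL): every probability weak limit of the pushed-forward critical
SAW laws along a mesh sequence `s_n → 0⁺` is carried by simple curve classes from `a = D.pt 0` to
`b = D.pt 1` with range in `cl D` meeting `∂D` only at `a, b`. Needs no-retracing and
no-boundary-crawling bounds at `x_c`. [cite: LawlerSchrammWerner2004SAW, §3.4] [cite: KennedyLawler2013, §1.2] -/
theorem stub_simpleSubseqLimits : ∀ (D : Literature.Probability.RandomPlanarGeometry.DobrushinDomain) (a b : ℝ → Literature.Probability.LatticeModels.Site 2), Literature.Probability.RandomPlanarGeometry.SAW.IsEndpointApprox D a b → ∀ (s : ℕ → ℝ) (ν : MeasureTheory.Measure (Literature.Probability.RandomPlanarGeometry.CurveClass ℂ)), Filter.Tendsto s Filter.atTop (nhdsWithin 0 (Set.Ioi 0)) → MeasureTheory.IsProbabilityMeasure ν → (∀ f : BoundedContinuousFunction (Literature.Probability.RandomPlanarGeometry.CurveClass ℂ) ℝ, Filter.Tendsto (fun n => ∫ γ, f γ.curve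 ∂(Literature.Probability.RandomPlanarGeometry.SAW.law D.carrier (s n) (a (s n)) (b (s n)))) Filter.atTop (nhds (∫ x, f x ∂ν))) → ∀ᵐ γ ∂ν, γ ∈ Literature.Probability.RandomPlanarGeometry.CurveClass.simple ∧ γ.source = D.pt 0 ∧ γ.target = D.pt 1 ∧ γ.range ⊆ closure D.carrier ∧ γ.range ∩ frontier D.carrier ⊆ {D.pt 0, D.pt 1} := by
  sorry

/-- **Stub (P) — AVOIDANCE PASSAGE, compact-`K` form** (new; provable now, size M): under an endpoint
approximation, if for a probability measure `μ` on `CurveClass ℂ` the lattice avoidance probabilities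
`P_δ(range ∩ K = ∅)` converge along `𝓝[>] 0` to `μ(range ∩ K = ∅)` for every compact regular-closed
`K ⊆ D`, then every probability weak limit `ν` of the pushed-forward SAW laws along `s_n → 0⁺` satisfies
`ν(range ∩ K = ∅) = μ(range ∩ K = ∅)` for all such `K`. Portmanteau: the event is open (`≤`); for `≥` use
the closed events `{range ∩ U = ∅}`, `U = thickening ε K`, squeezed by the compact regular-closed
`cthickening ε K ⊆ D` and `μ`-continuity from below as `ε ↓ 0` (ranges are compact). Compact-`K` twin of
the proved `AvoidancePassage` (stmt-4984). [cite: BillingsleyCPM1999, Thm 2.1] [cite: LawlerSchrammWerner2003Restriction, Lemma 3.2] -/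
theorem stub_avoidancePassageK : ∀ (D : Literature.Probability.RandomPlanarGeometry.DobrushinDomain) (a b : ℝ → Literature.Probability.LatticeModels.Site 2), Literature.Probability.RandomPlanarGeometry.SAW.IsEndpointApprox D a b → ∀ (μ : MeasureTheory.Measure (Literature.Probability.RandomPlanarGeometry.CurveClass ℂ)), MeasureTheory.IsProbabilityMeasure μ → (∀ K : Set ℂ, IsCompact K → K ⊆ D.carrier → closure (interior K) = K → Filter.Tendsto (fun δ : ℝ => ((Literature.Probability.RandomPlanarGeometry.SAW.law D.carrier δ (a δ) (b δ)) {γ | γ.curve.range ∩ K = ∅}).toReal) (nhdsWithin (0 : ℝ) (Set.Ioi 0)) (nhds (μ {γ | γ.range ∩ K = ∅}).toReal)) → ∀ (s : ℕ → ℝ) (ν : MeasureTheory.Measure (Literature.Probability.RandomPlanarGeometry.CurveClass ℂ)), Filter.Tendsto s Filter.atTop (nhdsWithin 0 (Set.Ioi 0)) → MeasureTheory.IsProbabilityMeasure ν → (∀ f : BoundedContinuousFunction (Literature.Probability.RandomPlanarGeometry.CurveClass ℂ) ℝ, Filter.Tendsto (fun n => ∫ γ, f γ.curve ∂(Literature.Probability.RandomPlanarGeometry.SAW.law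 D.carrier (s n) (a (s n)) (b (s n)))) Filter.atTop (nhds (∫ x, f x ∂ν))) → ∀ K : Set ℂ, IsCompact K → K ⊆ D.carrier → closure (interior K) = K → ν {γ | γ.range ∩ K = ∅} = μ {γ | γ.range ∩ K = ∅} := by
  sorry

/-- **Stub (D) — AVOIDANCE OF REGULAR-CLOSED COMPACTA DETERMINES LAWS ON SIMPLE CHORDS** (new; provable
now, size M–L): two probability measures on `CurveClass ℂ`, both carried by simple curve classes from
`a` to `b` with range in `cl D` meeting `∂D` only at `a, b`, which give the same mass to every event
`{range ∩ K = ∅}` for `K ⊆ D` compact with `closure (interior K) = K`, are equal. These events form a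
π-system (`K₁ ∪ K₂` is again compact regular-closed) separating simple chords (small closed discs inside
`D` on a dense sequence; a simple chord meeting `∂D` only at `a, b` is the closure of its trace in `D`;
a simple class is determined by its range and starting point, `CurveClass.eq_of_mem_simple_of_range_eq`),
and Lusin–Souslin transfers (`CurveClass.Measure.ext_of_missCode_injOn`). Compact-`K` twin of the proved
`AvoidanceDeterminesLaw` (stmt-1373); false without the `simple` carrier
(`avoidanceDeterminesLaw_false_without_simple`). [cite: LawlerSchrammWerner2003Restriction, Lemma 3.2] [cite: AizenmanBurchard1999, §2.1] -/
theorem stub_avoidanceDeterminesLawK : ∀ (D : Literature.Probability.RandomPlanarGeometry.DobrushinDomain) (μ ν : MeasureTheory.Measure (Literature.Probability.RandomPlanarGeometry.CurveClass ℂ)), MeasureTheory.IsProbabilityMeasure μ → MeasureTheory.IsProbabilityMeasure ν → (∀ᵐ γ ∂μ, γ ∈ Literature.Probability.RandomPlanarGeometry.CurveClass.simple ∧ γ.source = D.pt 0 ∧ γ.target = D.pt 1 ∧ γ.range ⊆ closure D.carrier ∧ γ.range ∩ frontier D.carrier ⊆ {D.pt 0, D.pt 1}) → (∀ᵐ γ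 ∂ν, γ ∈ Literature.Probability.RandomPlanarGeometry.CurveClass.simple ∧ γ.source = D.pt 0 ∧ γ.target = D.pt 1 ∧ γ.range ⊆ closure D.carrier ∧ γ.range ∩ frontier D.carrier ⊆ {D.pt 0, D.pt 1}) → (∀ K : Set ℂ, IsCompact K → K ⊆ D.carrier → closure (interior K) = K → μ {γ | γ.range ∩ K = ∅} = ν {γ | γ.range ∩ K = ∅}) → μ = ν := by
  sorry

/-! Consistency: each registered theorem statement IS the corresponding `Stubs` `Prop` (definitional). -/

example : Stubs.stub_eventualTight := stub_eventualTight
example : Stubs.stub_simpleSubseqLimits := stub_simpleSubseqLimits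
example : Stubs.stub_avoidancePassageK := stub_avoidancePassageK
example : Stubs.stub_avoidanceDeterminesLawK := stub_avoidanceDeterminesLawK

/-! Pins (documentation): (T) and (S) ARE the shared items, by `Iff.rfl`. -/

/-- (T) is verbatim the shared item `EventualTight` (stmt-CriticalPhenomena-1372, here through its
`SAWWeldingIdentification` copy). -/
theorem stub_eventualTight_iff_item1372 :
    Stubs.stub_eventualTight ↔
      Summit.CriticalPhenomena.SAWScalingLimit.Theses.SAWWeldingIdentification.EventualTight :=
  Iff.rfl

/-- (S) is verbatim the shared crux `SAWLoopFugacityFlow.SimpleSubseqLimits` (stmt-CriticalPhenomena-4982). -/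
theorem stub_simpleSubseqLimits_iff_item4982 :
    Stubs.stub_simpleSubseqLimits ↔
      Summit.CriticalPhenomena.SAWScalingLimit.Theses.SAWLoopFugacityFlow.SimpleSubseqLimits :=
  Iff.rfl

/-! ## The composition: the four stubs imply the crux BY NAME (kernel-checked, no `sorry`) -/

/-- **`AvoidanceToCurves` from (T), (S), (P), (D).** Fix `(D; a, b)`, an endpoint approximation, an
SLE_{8/3} law `μ = preWienerMeasure.map Γ` and the convergence of the lattice `K`-avoidance
probabilities to those of `μ`. By `SLECarrier_proof` (tree, stmt-4985) `μ` is a probability measure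
carried by simple chords of `(D; a, b)`. Every probability weak limit `P` of the pushed-forward SAW laws
along positive meshes `δ_n → 0` is carried by simple chords (S) and has the `K`-avoidance masses of `μ`
(P), hence `P = μ` (D). With (T), the tree's Prokhorov upgrade for eventually-probability laws
`limitUpgrade_proof` (stmt-4508; Billingsley Thm 5.1 Corollary) gives `TendstoLaw (curve) (SAW.law) id μ`,
i.e. `TendstoLaw (curve) (SAW.law) Γ preWienerMeasure` by `integral_map`; the curve observable is
measurable at every mesh (`SAW.aemeasurable_curve`). [cite: BillingsleyCPM1999, Thm. 5.1, Corollary] -/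
theorem AvoidanceToCurves_of :
    Stubs.stub_eventualTight → Stubs.stub_simpleSubseqLimits → Stubs.stub_avoidancePassageK →
      Stubs.stub_avoidanceDeterminesLawK →
      Summit.CriticalPhenomena.SAWScalingLimit.Theses.SAWLoopLift.AvoidanceToCurves := by
  intro hT hS hP hD D a b hab μ hμ havoid
  -- SLE side (tree theorem): `μ` is a probability law carried by simple chords of `(D; a, b)`
  obtain ⟨hμprob, hμcar⟩ := Summit.CriticalPhenomena.SAWScalingLimit.Theorems.SLECarrier_proof D μ hμ
  obtain ⟨Γ, hΓ, hμΓ⟩ := hμ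
  refine ⟨Γ, hΓ, Filter.Eventually.of_forall fun δ => SAW.aemeasurable_curve D.carrier δ (a δ) (b δ), ?_⟩
  -- identification of every probability subsequential weak limit with `μ`: (S) + (P) + (D)
  have hident : ∀ (P : MeasureTheory.Measure (CurveClass ℂ)), MeasureTheory.IsProbabilityMeasure P →
      ∀ (δs : ℕ → ℝ), (∀ n, 0 < δs n) → Filter.Tendsto δs Filter.atTop (nhds 0) →
      (∀ f : BoundedContinuousFunction (CurveClass ℂ) ℝ, Filter.Tendsto
        (fun n => ∫ γ, f γ.curve ∂(SAW.law D.carrier (δs n) (a (δs n)) (b (δs n)))) Filter.atTop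
        (nhds (∫ γ, f γ ∂P))) → P = μ := by
    intro P hPprob s hpos hs0 hlim
    have hs : Filter.Tendsto s Filter.atTop (nhdsWithin 0 (Set.Ioi 0)) :=
      tendsto_nhdsWithin_iff.2 ⟨hs0, Filter.Eventually.of_forall fun n => Set.mem_Ioi.2 (hpos n)⟩
    have hPcar := hS D a b hab s P hs hPprob hlim
    have hPK := hP D a b hab μ hμprob havoid s P hs hPprob hlim
    exact hD D P μ hPprob hμprob hPcar hμcar hPK
  -- eventual tightness (T) + identification ⟹ convergence in law to `μ` (tree: Prokhorov upgrade)
  have hlaw := Summit.CriticalPhenomena.SAWScalingLimit.Theorems.limitUpgrade_proof D a b hab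
    (hT D a b hab) μ hμprob hident
  intro f
  have h := hlaw f
  simp only [id] at h
  rw [hμΓ, integral_map hΓ.aemeasurable f.continuous.aestronglyMeasurable] at h
  exact h

/-- Wiring check: the crux BY NAME from the four registered (sorried) stubs — the stub theorems are
exactly the hypotheses of `AvoidanceToCurves_of` (inherits their `sorry`; nothing is claimed). -/
example : Summit.CriticalPhenomena.SAWScalingLimit.Theses.SAWLoopLift.AvoidanceToCurves :=
  AvoidanceToCurves_of stub_eventualTight stub_simpleSubseqLimits stub_avoidancePassageK
    stub_avoidanceDeterminesLawK

end Summit.CriticalPhenomena.SAWScalingLimit.Cruxes.AvoidanceToCurves.Birth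

end
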